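import Mathlib.Tactic
import Literature.Computability.Complexity.Promise
import Literature.Computability.Complexity.BPClosureProofs
import Literature.Computability.Cryptography.ClassBQP
import Literature.Computability.QuantumComplexity.ForrelationComplete
import Literature.Computability.QuantumComplexity.ForrelationCompleteHolds
import Summits.QuantumAdvantage.QuantumAdvantage.Statement
import Summits.QuantumAdvantage.QuantumAdvantage.Theorems.SoloInformedPseudoDeterministicLift
import Summits.QuantumAdvantage.QuantumAdvantage.Theorems.SoloInformedPromiseLiftPP
import Summits.QuantumAdvantage.QuantumAdvantage.Theorems.SoloInformedPromiseSepIffSummit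
import Summits.QuantumAdvantage.QuantumAdvantage.Theorems.SoloInformedLiftDichotomy
import Summits.QuantumAdvantage.QuantumAdvantage.Theorems.SoloInformedHardLanguage
import HarnessLib

/-!
# SoloInformedForrelationTrichotomy — the summit read off the position of ONE promise problem

Solo seat `solo-QuantumAdvantage-informed` (ideation tier, summit-directed). All statements UNCONDITIONAL (the
Aaronson–Ambainis completeness of poly-fold Forrelation is the tree theorem
`aaronson_ambainis_kForrelation_complete_holds`). Write `K := kForrelationProblem` and recall the chain
`PromiseBPP ⊆ promiseLift BQP ⊆ PromiseBQP ∋ K`.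

* `mem_promiseLift_BPP_of_polyTimeReducible` — `PromiseBPP = promiseLift BPP` is closed under Karp reductions of
  promise problems (preimages of `BPP` languages under `FP` maps are in `BPP`);
* `promiseSep_iff_kForrelation_not_mem_PromiseBPP : ¬(PromiseBQP ⊆ PromiseBPP) ↔ K ∉ PromiseBPP`;
* `kForrelation_not_mem_PromiseBPP_of_quantumAdvantage` — **a necessary condition for the summit: no `BPP` language
  solves poly-fold Forrelation** (and then `PP ⊄ BPP`, `not_PP_subset_BPP_of_kForrelation_not_mem_PromiseBPP`);
* `quantumAdvantage_of_kForrelation_window : K ∈ promiseLift BQP → K ∉ PromiseBPP → QuantumAdvantage` — **a sufficient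
  condition: Forrelation sits in the window `promiseLift BQP ∖ PromiseBPP`**; and
  `quantumAdvantage_iff_kForrelation_not_mem_PromiseBPP_of_lift`;
* the TRICHOTOMY by the position of `K`: `K ∈ PromiseBPP ⇒ Q-EXT ∧ ¬summit`
  (`promiseIsLift_and_not_quantumAdvantage_of_kForrelation_mem_PromiseBPP`); `K` in the window `⇒ summit`;
  `K ∉ promiseLift BQP ⇒ ¬Q-EXT ∧ PromiseBQP ⊄ PromiseBPP` (`not_promiseIsLift_and_promiseSep_of_kForrelation_not_lift`)
  — the third case being exactly the one in which the door of this programme is shut and the summit is the residual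
  question; `kForrelation_trichotomy` packages the three cases.

[cite: AaronsonAmbainis2018, §6 (Prop. 6, Lemma 24, Thm. 25)] [cite: Goldreich2006, Def. 1.2 and Def. 1.4]
[cite: AroraBarakCC2009, §7.6 (Def. 7.16)] [cite: Watrous2009, §III.2]
-/

noncomputable section

namespace Summit.QuantumAdvantage.QuantumAdvantage.Theorems

open _root_.Computability Literature.Computability.Complexity Literature.Computability.Cryptography
  Literature.Computability.QuantumComplexity

/-- **`promiseLift BPP` is closed under Karp reductions of promise problems**: if `Q₁ ≤ Q₂` via `f ∈ FP` and
`L ∈ BPP` solves `Q₂`, then `f⁻¹(L) ∈ BPP` solves `Q₁`. [cite: AroraBarakCC2009, §7.6 (Def. 7.16)]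
[cite: Goldreich2006, Def. 1.2 and Def. 1.4] -/
theorem mem_promiseLift_BPP_of_polyTimeReducible {Q₁ Q₂ : PromiseProblem} (h : Q₁.PolyTimeReducible Q₂)
    (h₂ : Q₂ ∈ promiseLift BPP) : Q₁ ∈ promiseLift BPP := by
  obtain ⟨L, hL, hyes, hno⟩ := h₂
  obtain ⟨f, hf, hfy, hfn⟩ := h
  exact ⟨f ⁻¹' L, preimage_mem_BPP hL hf, fun x hx => hyes (hfy hx), fun x hx => hno (hfn hx)⟩

/-- **`PromiseBQP ⊄ PromiseBPP ⟺ K ∉ PromiseBPP`** for `K = kForrelationProblem` (completeness + closure of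
`PromiseBPP = promiseLift BPP` under reductions). [cite: AaronsonAmbainis2018, §6 (Thm. 25)]
[cite: Goldreich2006, Def. 1.4] -/
theorem promiseSep_iff_kForrelation_not_mem_PromiseBPP :
    ¬ PromiseBQP ⊆ PromiseBPP ↔ kForrelationProblem ∉ PromiseBPP := by
  constructor
  · intro hSep hK
    exact hSep fun Q hQ =>
      mem_promiseLift_BPP_of_polyTimeReducible (aaronson_ambainis_kForrelation_complete_holds.2 Q hQ) hK
  · intro hK hsub
    exact hK (hsub aaronson_ambainis_kForrelation_complete_holds.1)

/-- **Necessary condition for the summit: no `BPP` language solves poly-fold Forrelation.**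
[cite: AaronsonAmbainis2018, §6 (Thm. 25)] [cite: Goldreich2006, Def. 1.2] -/
theorem kForrelation_not_mem_PromiseBPP_of_quantumAdvantage (h : QuantumAdvantage) :
    kForrelationProblem ∉ PromiseBPP :=
  promiseSep_iff_kForrelation_not_mem_PromiseBPP.1 (promiseSep_of_quantumAdvantage h)

/-- … and that necessary condition already carries the floor `PP ⊄ BPP`.
[cite: AdlemanDeMarraisHuang1997, Thm. (BQP ⊆ PP)] [cite: AaronsonAmbainis2018, §6 (Thm. 25)] -/
theorem not_PP_subset_BPP_of_kForrelation_not_mem_PromiseBPP (hK : kForrelationProblem ∉ PromiseBPP) :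
    ¬ PP ⊆ BPP :=
  not_PP_subset_BPP_of_promiseSep (promiseSep_iff_kForrelation_not_mem_PromiseBPP.2 hK)

/-- **Sufficient condition for the summit: Forrelation in the window `promiseLift BQP ∖ PromiseBPP`.**
(`K ∈ promiseLift BQP ⟺ Q-EXT` by completeness; `K ∉ PromiseBPP ⟺ PromiseBQP ⊄ PromiseBPP`; then file 1.)
[cite: AaronsonAmbainis2018, §6 (Thm. 25)] [cite: Goldreich2006, Def. 1.2 and Def. 1.4] -/
theorem quantumAdvantage_of_kForrelation_window (hlift : kForrelationProblem ∈ promiseLift BQP)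
    (hK : kForrelationProblem ∉ PromiseBPP) : QuantumAdvantage :=
  quantumAdvantage_of_promiseIsLift
    ((promiseIsLift_iff_kForrelation_lifts aaronson_ambainis_kForrelation_complete_holds).2 hlift)
    (promiseSep_iff_kForrelation_not_mem_PromiseBPP.2 hK)

/-- **If Forrelation lifts, the summit is exactly `K ∉ PromiseBPP`.** [cite: AaronsonAmbainis2018, §6 (Thm. 25)]
[cite: Goldreich2006, Def. 1.2] -/
theorem quantumAdvantage_iff_kForrelation_not_mem_PromiseBPP_of_lift (hlift : kForrelationProblem ∈ promiseLift BQP) :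
    QuantumAdvantage ↔ kForrelationProblem ∉ PromiseBPP :=
  ⟨kForrelation_not_mem_PromiseBPP_of_quantumAdvantage, quantumAdvantage_of_kForrelation_window hlift⟩

/-! ### The trichotomy by the position of `K` in `PromiseBPP ⊆ promiseLift BQP ⊆ PromiseBQP` -/

/-- **Case 1: `K ∈ PromiseBPP`** — then `PromiseBQP ⊆ PromiseBPP`, so `Q-EXT` holds and the summit fails.
[cite: AaronsonAmbainis2018, §6 (Thm. 25)] [cite: Goldreich2006, Def. 1.2] -/
theorem promiseIsLift_and_not_quantumAdvantage_of_kForrelation_mem_PromiseBPP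
    (hK : kForrelationProblem ∈ PromiseBPP) : PromiseBQP ⊆ promiseLift BQP ∧ ¬ QuantumAdvantage := by
  have hsub : PromiseBQP ⊆ PromiseBPP := by
    by_contra h
    exact promiseSep_iff_kForrelation_not_mem_PromiseBPP.1 h hK
  exact promiseIsLift_and_not_quantumAdvantage_of_not_promiseSep hsub

/-- **Case 3: `K ∉ promiseLift BQP`** — then `Q-EXT` fails and `PromiseBQP ⊄ PromiseBPP` (the door is shut; the summit
is the residual question). [cite: AaronsonAmbainis2018, §6 (Thm. 25)] [cite: Goldreich2006, Def. 1.2] -/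
theorem not_promiseIsLift_and_promiseSep_of_kForrelation_not_lift (hK : kForrelationProblem ∉ promiseLift BQP) :
    ¬ PromiseBQP ⊆ promiseLift BQP ∧ ¬ PromiseBQP ⊆ PromiseBPP := by
  have hn : ¬ PromiseBQP ⊆ promiseLift BQP := fun hExt =>
    hK ((promiseIsLift_iff_kForrelation_lifts aaronson_ambainis_kForrelation_complete_holds).1 hExt)
  exact ⟨hn, promiseSep_of_not_promiseIsLift hn⟩

/-- **The Forrelation trichotomy.** Exactly one explicit promise problem decides everything the door decides:
`K ∈ PromiseBPP` (no advantage, `Q-EXT`), or `K ∈ promiseLift BQP ∖ PromiseBPP` (the summit holds), or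
`K ∉ promiseLift BQP` (`¬Q-EXT`, promise separation, summit undetermined by this analysis).
[cite: AaronsonAmbainis2018, §6 (Thm. 25)] [cite: Goldreich2006, Def. 1.2 and Def. 1.4] -/
theorem kForrelation_trichotomy :
    (kForrelationProblem ∈ PromiseBPP ∧ PromiseBQP ⊆ promiseLift BQP ∧ ¬ QuantumAdvantage) ∨
    (kForrelationProblem ∈ promiseLift BQP ∧ kForrelationProblem ∉ PromiseBPP ∧ QuantumAdvantage) ∨
    (kForrelationProblem ∉ promiseLift BQP ∧ ¬ PromiseBQP ⊆ promiseLift BQP ∧ ¬ PromiseBQP ⊆ PromiseBPP) := by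
  by_cases h1 : kForrelationProblem ∈ PromiseBPP
  · exact Or.inl ⟨h1, promiseIsLift_and_not_quantumAdvantage_of_kForrelation_mem_PromiseBPP h1⟩
  · by_cases h2 : kForrelationProblem ∈ promiseLift BQP
    · exact Or.inr (Or.inl ⟨h2, h1, quantumAdvantage_of_kForrelation_window h2 h1⟩)
    · exact Or.inr (Or.inr ⟨h2, not_promiseIsLift_and_promiseSep_of_kForrelation_not_lift h2⟩)

end Summit.QuantumAdvantage.QuantumAdvantage.Theorems

end
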